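import Literature.NumberTheory.GaloisRepresentations.ArtinConductorHerbrandProofs
import Literature.NumberTheory.GaloisRepresentations.SerreWeightExistenceProofs
import Literature.NumberTheory.GaloisRepresentations.TameInertiaKummerProofs
import HarnessLib

/-!
# `2 ≤ k(ρ̄_F)` unconditionally (trunk GalRep, items C15/C16; Serre's weight recipe)

D-0014 keeps `Literature/` sorry-free by stating cited results as named facts `def X : Prop`.
This sibling file of `Literature.NumberTheory.GaloisRepresentations.SerreWeight` discharges the
named fact `Literature.ModPGaloisRep.two_le_serreWeightLocal ρ ι` — **the lower bound `2 ≤ k(ρ̄_F)` for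
Serre's weight of a two-dimensional mod `p` representation `ρ̄_F : Γ_F → GL₂(k)` of a
non-archimedean local field `F`** (Serre, Duke Math. J. 54 (1987), n° 2.6 "Valeurs de `k`":
`2 ≤ k ≤ p² - 1` for `p ≠ 2`, `k ∈ {2, 4}` for `p = 2`; the fact's docstring locates it at §2.4,
Remarque) — for every `ρ̄` (`k` discrete) and every residue embedding `ι`:

* `Literature.ModPGaloisRep.two_le_serreWeightLocal_holds ρ ι : ρ.two_le_serreWeightLocal ι`.

The tree already reduces the bound to Serre's Prop. 1 (existence of an inertia shape,
`exists_isSerreWeight`): `SerreWeightShapeProofs.two_le_serreWeightLocal_of_exists` (each case of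
the recipe gives a value `≥ 2`, `two_le_of_isSerreWeight`, and the weight is a value of the recipe,
`isSerreWeight_serreWeightLocal_of`).  Prop. 1 itself is
`SerreWeightExistenceProofs.ModPGaloisRep.exists_isSerreWeight_holds_of_herbrand_quotient` — the
assembly of `SerreWeightShapeProofs` with the wild inertia `p`-group
(`TameInertiaProofs.absUpperInertia_map_isPGroup_holds`) and the cyclicity of tame inertia
(through the surjectivity `I_F^v ↠ Gal(E/F)^v` in every characteristic) — on two hypotheses:
Herbrand's theorem at the finite layers of `F̄` (`herbrand_quotient`), which is the theorem
`ArtinConductorHerbrandProofs.herbrand_quotient_holds`, and `exists_eq_kummerCharacter_pow F k`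
(the characters of `I_F` of exponent prime to `p` are powers of `θ_d`; Serre, Invent. Math. 15
(1972), §1.7 Prop. 5), which is the theorem `TameInertiaKummerProofs.exists_eq_kummerCharacter_pow_holds`.
This file feeds the two theorems into that assembly.

## References

* J.-P. Serre, *Sur les représentations modulaires de degré 2 de `Gal(ℚ̄/ℚ)`*, Duke Math. J. 54
  (1987), §2.1 Prop. 1, §2.2–2.4, n° 2.6. [Serre1987]
* J.-P. Serre, *Propriétés galoisiennes des points d'ordre fini des courbes elliptiques*, Invent.
  Math. 15 (1972), §1.7 Prop. 5. [SerreInventiones1972]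
* J.-P. Serre, *Local Fields*, GTM 67 (1979), Ch. IV §2 Cor. 1 and Cor. 3 of Prop. 7, §3 Prop. 14.
  [SerreLocalFields1979]
-/

noncomputable section

open scoped Valued
open ValuativeRel Field

namespace Literature.NumberTheory.GaloisRepresentations

open GaloisRepresentations.IsNonarchimedeanLocalField

universe u v

variable {F : Type u} [Field F] [ValuativeRel F] [TopologicalSpace F] [IsNonarchimedeanLocalField F]
variable {k : Type v} [Field k] [TopologicalSpace k]

/-- **Discharge of `ModPGaloisRep.two_le_serreWeightLocal`: `2 ≤ k(ρ̄_F)`.**  For every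
continuous `ρ̄ : Γ_F → GL₂(k)` over a discrete field `k` and every residue embedding
`ι : S ⧸ 𝔓 →+* k`, Serre's weight `serreWeightLocal ρ ι` is at least `2`: an inertia shape
exists (Serre's Prop. 1: `exists_isSerreWeight_holds_of_herbrand_quotient` with
`herbrand_quotient_holds` and `exists_eq_kummerCharacter_pow_holds`), so the weight is one of the
values of the recipe, each of
which is `≥ 2` (level two: `m = 1 + q a + b` with `b ≥ 1`; tame: `m = q` or `1 + q a + b ≥ 2`;
wild: `β ≥ 1`), `two_le_serreWeightLocal_of_exists`.
Ref: Serre, Duke Math. J. 54 (1987), §2.1 Prop. 1 and n° 2.6 ("Valeurs de `k`": `2 ≤ k`), with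
the normalisations (2.2.3), (2.3.1)–(2.3.2), (2.4.3)–(2.4.5), (2.4.8)–(2.4.9).
[cite: Serre1987, §2.4 Remarque (2 ≤ k ≤ p²-1)] [cite: Serre1987, §2.1 Prop. 1; §2.2–2.4] -/
theorem ModPGaloisRep.two_le_serreWeightLocal_holds (ρ : ModPGaloisRep F k 2)
    (ι : absIntegers 𝒪[F] F ⧸ absMaximalIdeal F →+* k) : ρ.two_le_serreWeightLocal ι :=
  ModPGaloisRep.two_le_serreWeightLocal_of_exists ρ ι
    (ModPGaloisRep.exists_isSerreWeight_holds_of_herbrand_quotient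
      (fun hle => herbrand_quotient_holds 𝒪[F] (IntermediateField.restrict hle))
      (exists_eq_kummerCharacter_pow_holds F k) ρ ι)

end Literature.NumberTheory.GaloisRepresentations
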